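import Mathlib
import HarnessLib
import HarnessLib.Audit
import Summits.QuantumAdvantage.Statement
import Literature.Computability.Complexity.ConstantDepth
import Literature.Computability.QuantumComplexity.StabilizerRank
import Literature.Computability.Cryptography.TCount
import Literature.Computability.Complexity.Nondeterministic
import Literature.Computability.Complexity.Circuit
import Literature.Computability.Complexity.ProbabilisticClasses
import Literature.Computability.Cryptography.QuantumCircuit

/-!
Route: CliffordParallel

CLOSED (retired) 2026-08-15T13:50:50Z by operator:999:1257524 — reason: not-a-thesis: assembly does not conclude the sub-problem Statement — note: D-0027 §2.1 audit (human 2026-08-15: routes that do not decide the summit are removed): the assembly concludes `ThresholdHypothesisKill`, not the sub-problem statement; a NEW conforming route may be opened from the same idea (generated `closes : … → _root_.QuantumAdvantage`).. The file is kept as the record of this route; refuted decls are indexed as negative knowledge (`ledger negatives`).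

# Route CliffordParallel — polynomial (approximate) stabilizer rank of magic states would put BQP in
TC⁰/poly and PP in NP — kills of 0247 from TC⁰- and NP≠coNP-type hypotheses

Card clifford-is-parallel, sharpened. "Clifford is parallel" is an understatement once the
stabilizer decomposition is ADVICE: the
input x enters a gadgetized stabilizer-rank simulation only as a computational-basis LABEL, and a
diagonal matrix element
⟨x|C†PC'|x⟩ of a fixed Clifford sandwich is (power of √2)·[affine test on x]·ω^(quadratic polynomial
in x mod 8)
(Dehaene–De Moor / Van den Nest normal form + one Gauss sum over the internal register, all
x-independent data being advice).
So the per-input residue is TC⁰, not NC³, and by a branch-averaging identity for the corrected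
T-gadget plus Adleman's
union bound a CONSTANT precision δ suffices. It suffices to show X = X_A ∧ X_U ∧ X_C:
X_A: poly-size, poly-bit (1/10)-approximate stabilizer decompositions of |T⟩^⊗t for all t ⇒ BQP ⊆
TC0 (the tree's non-uniform TC⁰);
X_U: poly-size, poly-bit EXACT decompositions ⇒ PP ⊆ NP (uniform: guess the sparse
stabilizer-function representation of every
gate of a #SAT instance, verify it by exact Gauss sums à la Williams' Sum-Product lemma, then
count);
X_C: the same exact hypothesis ⇒ PP ⊆ TC0 (non-uniform, via the proved PP ⊆ PostBQP).
With two bit-reduction lemmas (support) the contrapositives are the TARGET: ¬(BQP ⊆ TC0) →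
Dequantize's kill item
DeqNegStabrankSuperpoly (stmt-0247, verbatim); ¬(PP ⊆ TC0) ∨ ¬(PP ⊆ NP) → GenericAngle's
ExactRankSuperpoly (stmt-1794, verbatim).
Lean: `(¬ (Literature.Computability.Cryptography.BQP ⊆ Literature.Computability.Complexity.TC0) → ∃
δ : ℝ, 0 < δ ∧ δ < 1 ∧ ∀ c : ℕ, ∃ t : ℕ, t ^ c + c <
Literature.Computability.QuantumComplexity.approxStabilizerRank δ
(Literature.Computability.QuantumComplexity.tensorPow
Literature.Computability.QuantumComplexity.magicT t)) ∧ (¬ (Literature.Computability.Complexity.PP ⊆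
Literature.Computability.Complexity.TC0) ∨ ¬ (Literature.Computability.Complexity.PP ⊆
Literature.Computability.Complexity.Nondeterministic.NP) → ∀ c : ℕ, ∃ t : ℕ, t ^ c + c <
Literature.Computability.QuantumComplexity.stabilizerRank
(Literature.Computability.QuantumComplexity.tensorPow
Literature.Computability.QuantumComplexity.magicT t))`

## Assembly
Pure logic (theorem assembly_holds in Sketch.lean, sorry-free): for the first conjunct assume ¬(BQP
⊆ TC0) and, towards 0247 with
δ = 1/20, suppose ∃c ∀t χ_(1/20)(T^⊗t) ≤ t^c+c; PolyBitsOfApproxRank gives the data hypothesis,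
ApproxRankThresholdCollapse gives
BQP ⊆ TC0, contradiction. For the second conjunct suppose ∃c ∀t χ(T^⊗t) ≤ t^c+c; PolyBitsOfExactRank
gives exact data, and
ExactRankCountingCollapse resp. ExactRankCertificateCollapse contradict ¬(PP ⊆ TC0) resp. ¬(PP ⊆
NP).

Rationale: WHY THIS LINE. Mehraban–Tahmasbi (arXiv:2305.10277) prove the only conditional superpolynomial
bounds in print — Thm 1.6 (exact rank, unless
P^#P ⊆ P/poly), Cor 1.9 (δ = 2^-Ω(n)), Thm 1.11 (constant δ, under an average-case #P-hardness
conjecture AND PH) — and ask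
explicitly (Remark 1.8, §2 p.9) whether P can be replaced by ⊕L/DET and whether the approximate
bound can rest on a mere
non-collapse. This line answers both with stronger statements: the x-dependence of every stabilizer
inner product is a quadratic
form (DehaeneDemoor2003 Thm 1–2, Vandennest2010 §3, BravyiGosset2016 App. A–C; tree
CliffordGaussSums/StabilizerProjector), so
poly rank collapses BQP (constant δ) resp. PP (exact) into non-uniform TC⁰, and Williams2018's
Sum-Product verification
(Lemma 3.1/Thm 3.1 there, where Sum-Product over stabilizer functions is not 2^(n−εn) but
POLYNOMIAL, being a Clifford Gauss sum)
turns exact poly rank into PP ⊆ NP, i.e. superpolynomial exact rank unless NP = coNP = P^#P.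
Imported areas: circuit complexity
(TC⁰ arithmetic ChandraStockmeyerVishkin1984/HesseAllenderBarrington2002, Adleman1978
derandomization, Williams' algorithmic
method) and the quadratic-Fourier description of stabilizer states (Labib2022, PelegShpilkaVolk2022
§1.3). On the hub: Dequantize/ModularRank/PauliFlat conclude BPP or P/poly; AmplitudeProofs
(ApcCookReckhow stmt-2701: AMP0 p-bounded iff
C=P ⊆ NP; ApcPrefixRankSuperpoly 2698; ApcPolyPrefixRankCollapse 2705: poly prefix ranks ⇒ BQP ⊆
P/poly) leaves 'poly exact rank ⇒
C=P ⊆ NP' one informal step away through its not-yet-defined SD calculus — crux 3 here types the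
stronger PP ⊆ NP now, calculus-free,
and nothing on the hub has the TC⁰ / constant-δ side (cruxes 2, 4); the negatives index (1 entry,
KummerSector) is untouched.

RANKED CRUXES. #0 ThresholdHypothesisKill (target) — (BQP ⊄ TC0/poly ⇒ superpolynomial δ-approximate
stabilizer rank of |T⟩^⊗t for some δ ∈ (0,1), i.e. item 0247 verbatim) ∧ (PP ⊄ TC0/poly or PP ⊄ NP ⇒
superpolynomial exact stabilizer rank, i.e. GenericAngle.ExactRankSuperpoly verbatim). (why it might
fail: It cannot fail given the cruxes (pure logic, proved in Sketch.lean); its VALUE fails if the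
hypotheses are as hard as 0247 itself: TC⁰ lower bounds for explicit languages face Natural Proofs
(NaorReingold2004 PRFs in TC⁰), NP ≠ coNP is P-vs-NP-hard.) [MehrabanTahmasbi2024, arXiv:2305.10277,
PelegShpilkaVolk2022, RazborovRudich1997, NaorReingold2004]
#2 ApproxRankThresholdCollapse (crux) — if for some c and all t there is a list of ≤ t^c+c (T-free,
oracle-free Clifford circuit on t wires, Gaussian-rational coefficient of height ≤ 2^(t^c+c)) pairs
whose combination of C_j|0^t⟩ is within norm² 1/100 of |T⟩^⊗t, then every BQP language has
polynomial-size constant-depth threshold circuits (tree TC0). Proof plan: amplify; gadgetize the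
t(n) T-gates with corrected gadgets V_y; branch identity ⟨y|V_y(|x0⟩⊗T^⊗t) = ω^|y| 2^(−t/2) U|x0⟩
and isometry ⇒ E_y[2^t‖v'_y−v_y‖²] ≤ 1/100; Markov + Chernoff + union bound over x fix O(n) advice
strings y; each p̂_y(x) = 2^t Σ c̄_i c_j ⟨x00|C_i†V_y†P V_y C_j|x00⟩ is a sum of χ² sandwich values
= advice constants × [affine tests] × ω^(quadratic(x)), evaluated and compared in TC⁰ (card K1,
sharpened from NC³/2^(−t/2) to TC⁰/constant δ). [deps: SandwichQuadraticForm] [difficulty: L] (why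
it might fail: Three exactness points: corrected-gadget branch identity; isometry of
measure-and-correct (Σ_y‖v'_y−v_y‖² = ‖ψ'−T^⊗t‖²); TC⁰ (DepthSizeClass tcBasis) iterated addition +
comparison of poly-bit ℤ[ω,½] numbers. δ=1/10 has slack (any δ<1/4 works); BQP needs amplification
first.) [BravyiGosset2016, BravyiEtAl2019, MehrabanTahmasbi2024, DehaeneDemoor2003, Vandennest2010,
Adleman1978, ChandraStockmeyerVishkin1984, arXiv:quant-ph/0406196]
#3 ExactRankCertificateCollapse (crux) — if the decompositions of crux 2 exist EXACTLY (equality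
instead of norm² ≤ 1/100), then PP ⊆ NP. Proof plan (Williams2018 Lemma 3.1 with C = stabilizer
functions): for a #SAT instance (the P-predicate of a pMajority language on inputs of length n+p(n),
as a fan-in-2 circuit), nondeterministically guess for every gate a representation Σ_i α_i s_i(x) by
≤ poly stabilizer functions s_i = 1_A·i^ℓ·(−1)^q with poly-bit α_i ∈ ℚ(ω) (they EXIST by
SparsityTransfer + Cramer); verify gate-by-gate the exact identities ρ_g = 1 − ρ_g1·ρ_g2 by
computing Σ_x|ρ_g − 1 + ρ_g1ρ_g2|² = 0 through O(r⁴) Sum-Products of ≤ 4 stabilizer functions, each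
a Clifford Gauss sum computed exactly in poly time; then Σ_x ρ_out(x) = Σ α_i Γ(s_i) is the exact
count; compare with half. [deps: SparsityTransfer, PolyBitsOfExactRank] [difficulty: L] (why it
might fail: Needs exact closure of stabilizer functions under pointwise product (i^a·i^b =
i^(a⊕b)(−1)^(ab)) and conjugation, exact poly-time Gauss sums (BG16 App. A; tree gaussEval), and
representations for EVERY gate with poly bits (Cramer over ℚ(ω)); T-count must stay O(circuit size)
(7 T per Toffoli).) [Williams2018, arXiv:1802.09121, BravyiGosset2016, MehrabanTahmasbi2024,
PelegShpilkaVolk2022, Labib2022]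
#4 ExactRankCountingCollapse (crux) — under the same exact hypothesis, PP ⊆ TC0 (non-uniform): by
the proved PP ⊆ PostBQP (tree PPPostBQPAssembly) every PP language has a uniform Clifford+T family
with postselection; with y = 0^t (no averaging needed for an exact resource) p(acc ∧ post) and
p(post) are 2^t × sums of χ² sandwich values, exact elements of ℤ[√2, 1/2] of poly bits computed in
TC⁰ from advice, and 3·p(acc∧post) ≥ 2·p(post) is decided exactly (TC⁰ multiplication). Corollaries
not filed: CH ⊆ TC0/poly, P^#P ⊆ TC0/poly (strengthening MT24 Thm 1.6's P^#P ⊆ P/poly). [deps: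
SandwichQuadraticForm] [difficulty: L] (why it might fail: PostBQP probabilities may be 2^(−poly):
the comparison must be EXACT in ℤ[√2,½] inside TC⁰ (needs TC⁰ multiplication,
HesseAllenderBarrington2002); any hidden approximation breaks it; the sandwich magnitude κ must be
x-independent (it is: the homogeneous constraint system does not see x).) [Aaronson2005,
MehrabanTahmasbi2024, BravyiGosset2016, DehaeneDemoor2003, HesseAllenderBarrington2002]
#9 PolyBitsOfApproxRank (support) — polynomial (1/20)-approximate stabilizer rank (tree
approxStabilizerRank, arbitrary complex coefficients, arbitrarily long Clifford words) ⇒ the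
poly-bit Gaussian-rational data hypothesis of crux 2 at precision 1/10: take an optimal φ' = Σ
c_iφ_i with φ_i linearly independent; ‖c‖ ≤ 2^poly because the Gram determinant is a nonzero element
of 2^(−tχ)ℤ[√2] (norm argument); round Re/Im of c_i to poly bits (extra error ≤ 1/20); words from
stabilizerStates t = Clifford orbit (convert Submonoid.closure placements to T-free QCircuit words).
[difficulty: M] [MehrabanTahmasbi2024, PelegShpilkaVolk2022, BravyiEtAl2019]
#9 PolyBitsOfExactRank (support) — polynomial exact stabilizer rank ⇒ the exact poly-bit data
hypothesis of cruxes 3–4: coefficients are the unique solution of a ℚ(ω)-linear system (Cramer: poly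
bits; MT24 proof of Thm 1.6, PSV22 §1.4), ℚ(ω) = ℚ(i) ⊕ ω·ℚ(i) and ω·φ is again a stabilizer state
((SH)³ = ω·1), so rank at most doubles with Gaussian-rational coefficients. [difficulty: M]
[MehrabanTahmasbi2024, PelegShpilkaVolk2022, AaronsonGottesman2004]
#9 SandwichQuadraticForm (support) — THE ENGINE. For T-free oracle-free circuits C, C' on N wires
and a coordinate projector P (pin the wires in S to the values v), the diagonal element x ↦
(C†·P·C')[x,x] on basis labels x ∈ 𝔽₂^N equals [R x = r over 𝔽₂]·(√2)^m·ω^((e + Σ a_j x_j + Σ B_jl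
x_j x_l) mod 8) for fixed integer data (m, R, r, e, a, B): Dehaene–De Moor form of the two Choi
states, product, Gauss sum over the internal register on an affine space whose homogeneous part is
x-independent (radical character test = affine in x; completed square = quadratic in x).
[difficulty: M] [DehaeneDemoor2003, Vandennest2010, BravyiGosset2016, GrierSchaeffer2019]
#9 SparsityTransfer (support) — polynomial exact stabilizer rank of |T⟩^⊗t ⇒ for every fan-in-2
Boolean circuit C on n inputs, the indicator vector Σ_x [C(x)]|x⟩ has stabilizer rank ≤ poly(size +
n): compile C reversibly into Clifford+T with 7 T per Toffoli and clean ancillas, apply the PROVED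
gadgetization fact BravyiGosset2016_stabilizerRank_output_le_holds to U|+ⁿ,0⟩ = 2^(−n/2)Σ_x|x, C(x),
0⟩ and project the output/ancilla wires (projection onto a basis value does not increase rank). The
Boolean-function face of the hypothesis used by crux 3 (PSV22 §1.4's remark, made uniform in the
circuit). [difficulty: M] [BravyiGosset2016, PelegShpilkaVolk2022, Williams2018]
#9 ClassicalThresholdCollapse (support) — the special case of crux 2 for classical languages: the
approximate data hypothesis ⇒ P ⊆ TC0 (reversible circuits have Boolean branch amplitudes a_y(x) =
ω^(−|y|)2^(t/2)⟨x,1,0,y|V_y(|x0⟩⊗ψ')⟩ ≈ L(x); no probabilities, no amplification) — the natural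
first target for provers and the form in which 'P ⊄ TC0/poly ⇒ 0247' is read. [difficulty: M]
[MehrabanTahmasbi2024, BravyiGosset2016, Adleman1978]
#9 LogTcountTC0 (support) — calibration rung (card P1, sharpened from P/NC² to TC⁰): a
poly-time-uniform oracle-free Clifford+T family with T-count ≤ c·log₂ n + c decides (gap 2/3,1/3)
only languages in TC0: expand T = αI + βZ into 4^t = poly sandwich terms, each
[affine]·(√2)^m·ω^quadratic by SandwichQuadraticForm, summed and compared in TC⁰ (sibling of
Dequantize.DeqLogTcountInPV2, which concludes P). [difficulty: M] [BravyiGosset2016,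
AaronsonGottesman2004, DehaeneDemoor2003]

TWO-LAYER PLAN. Foreseen glued splits (k ≤ 3, depth 1), filed only after a crux closes or stalls:
ApproxRankThresholdCollapse ⇐ BranchAveraging (gadget isometry + Adleman advice) →
SandwichQuadraticForm → TC0Arithmetic (iterated
addition/comparison of poly-bit ℤ[ω,½] numbers in DepthSizeClass tcBasis) →
ApproxRankThresholdCollapse;
ExactRankCertificateCollapse ⇐ SparsityTransfer(+PolyBits for Boolean vectors) → SumProductSTAB
(closure under product + exact
Gauss sums, from CliffordGaussSums.gaussEval) → ExactRankCertificateCollapse;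
ExactRankCountingCollapse ⇐ SandwichQuadraticForm → ExactPostBQPArithmetic (TC⁰ multiplication/sign
of a+b√2) → ExactRankCountingCollapse.

KILL CRITERIA. A refutation of SandwichQuadraticForm (an x-DEPENDENT magnitude or a non-polynomial
phase in some Clifford sandwich) kills cruxes 2
and 4 and LogTcountTC0 at once → close refuted unless crux 3 survives alone (then pivot to the
uniform certificate line only).
A refutation of the branch-averaging identity kills crux 2 only (pivot: keep δ = 2^(−t/2−2), the
card's original precision, where
y = 0^t needs no averaging). Crux 3 dies iff stabilizer functions are not closed under pointwise
product with computable data —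
they are (DDM03), so a refutation would expose a mis-formalised hypothesis format, to be restated.
MOOT (not killed) if 0247 is
proved elsewhere (CodeFlattening, MagicSpectrum, FermionicMagic, GenericAngle): the collapses remain
Literature-grade theorems.
If Dequantize's DeqStabrankPolyUniform (1036) is PROVED, crux 2 fires forward: BQP ⊆ TC0/poly.
Cross-route: crux 3 proved makes AmplitudeProofs'
SD/AMP0 systems p-bounded under the same hypothesis (PP ⊆ NP ⇒ AMP0 ∈ NP), and GenericAngle's target
becomes conditional on NP ≠ coNP.

NOT DECOMPOSED YET. TC⁰ arithmetic inside the tree's DepthSizeClass tcBasis (iterated addition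
CSV84, multiplication/sign HAB02) — layer-2 children;
BQP amplification to (99/100, 1/100) inside uniform families (tree BQPMajorityAmplification);
reversible Toffoli → Clifford+T
compilation with clean ancillas (tree ReversibleCliffordT); the bridge stabilizerStates t
(Submonoid.closure of placements) ↔ T-free
QCircuit words. Deliberately NOT filed: the card's K2 'method taxonomy' (its premise that constant-δ
simulation is
sequential-natured is refuted by the averaging + Adleman argument above) and K3 (P^(B⊕G) ⊄ NC^(B⊕G);
needs relativized NC);
the UNIFORM residue of the card / MT24 Remark 1.8 — is the PHASE of a Clifford amplitude (the Brown
invariant of an input-dependent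
ℤ₄-quadratic form) computable in ⊕L or NC? — irrelevant to the non-uniform theorems here, worth its
own card; the corollaries
CH ⊆ TC0/poly and P^#P = NP = coNP (need CH / oracle-PP plumbing in the tree).

CHEAPEST FALSIFIER. (i) Branch identity + averaging, numerically: with the tree's proved 7-term
decomposition of |T⟩^⊗6 (CliffordSimulator, BSS16) and
one Toffoli (7 T-gates, pad one T), compute a_y(x) = ω^(−|y|)2^(t/2)⟨x,Tof(x),0,y|V_y(|x0⟩⊗T^⊗7)⟩
for all 8 inputs and all 2^7 y:
must equal 1 exactly for every (x,y) — a few-minute kit job (not run: hub is compute-free and the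
identity is BG16 eq.(3)–(5)).
(ii) SandwichQuadraticForm on random 3–4-qubit Cliffords with one pinned wire: tabulate
|(C†PC')[x,x]| over x — any two NONZERO
magnitudes differing kills the engine. (iii) Lookup: a printed 'poly χ_δ ⇒ BQP ⊆ TC⁰/poly' or 'poly
χ ⇒ PP ⊆ NP' would downgrade
novelty, not truth (searched; not found — see Novelty).

NUMBERS. χ(T^⊗6) ≤ 7 (BravyiSmithSmolin2016; PROVED in tree), χ(T^⊗t) ≤ 2^(0.3963 t)
(QassimPashayanGosset2021); lower bounds: Ω(t) exact
(PelegShpilkaVolk2022 Thm 1.1), Ω̃(t²) δ-approximate for every δ < 1 (MehrabanTahmasbi2024 Thm 1.1).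
Conditional in print:
superpolynomial exact rank unless P^#P ⊆ P/poly (MT24 Thm 1.6), same at δ = 2^(−Ω(n)) (Cor 1.9),
constant δ under avg-case

DEFINITION REQUESTS. None required: every item is typed over StabilizerRank.lean, TCount.lean,
ConstantDepth.lean (TC0), ProbabilisticClasses.lean (PP),
Nondeterministic.lean (NP), Circuit.lean. Optional later (would shorten crux 3): a notion
`stabilizerFunction n` (1_A·i^ℓ·(−1)^q on
𝔽₂ⁿ) with its closure-under-product and Gauss-sum API, topic
Literature/Computability/QuantumComplexity.

Novelty: Searches (2026-08-15): `lit search --source all "stabilizer rank threshold circuits TC0 …"` (searchd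
rc 75 ×3, local index
unavailable); `lit search --source arxiv "stabilizer rank lower bound"` (30 rows: 2106.03214,
2305.10277, 2110.07781, 2503.04101,
2605.28586, 2410.24202 — none on TC⁰/NP collapses; `lit read 2605.28586 --grep
conditional|P/poly|coNP|threshold` 0 hits);
`lit galaxy search "stabilizer rank" --star all` (11 pdf rows: BBCCGH19, Labib thesis, OWR 49/2021,
2101.12223 … none);
`lit read arxiv:2305.10277` pp.5–9 (Thm 1.6, Rem 1.7–1.8, Cor 1.9, Thm 1.10–1.11, §2 p.9 open
questions); `lit read arxiv:1802.09121`
(Williams2018 Thm 1.5, Thm 3.1, Lemma 3.1); `lit read arxiv:2106.03214` pp.4–5 (§1.3–1.4: stabilizer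
functions, Williams, Cramer);
`lit read arxiv:quant-ph/0406196` §V (⊕L-completeness, Thm 4); `lit read arxiv:1911.02555`
(GrierSchaeffer2019: ⊕L = CliffordClass
chain NC⁰ ⊂ AC⁰ ⊂ AC⁰[2] ⊂ TC⁰ ⊆ NC¹ ⊆ L ⊆ ⊕L); grep of all 35 route files of the sub for
⊕L|NC/poly|P-complete|parallel (no route).
Nearest prior art found: MehrabanTahmasbi2024 Thm 1.6/Cor 1.9/Thm 1.10–1.11 + Remark 1.8 (asks for
⊕L/DET in place of P; gives
P/poly and BPP/poly conclusions); Williams2018 Lemma 3.1 (Sum-Product + sparse LIN∘C for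
Circuit-Eval ⇒ nondeterministic UNSAT,
never instantiated with stabilizer functions); PelegShpilkaVolk2022 §1.4 (superlinear χ ⇒
superlinear LIN∘quadratic bounds for
mod-8 functions); AaronsonGottesman2004 §V and GrierSchaeffer2019 (⊕L as the complexity of Cl  [refs: 2305.10277, 1802.09121, 2106.03214, quant-ph/0406196, 1911.02555, arxiv:2305.10277, arxiv:1802.09121, arxiv:2106.03214, arxiv:quant-ph/0406196, arxiv:1911.02555, Williams2018, GrierSchaeffer2019, MehrabanTahmasbi2024, PelegShpilkaVolk2022, AaronsonGottesman2004]

Barriers (technique_class: simulation-lower-bound, parallel-complexity, conditional): - technique_class: simulation-lower-bound, parallel-complexity, conditional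
- Literature.Barriers.QuantumAdvantage.Relativization: not met — the collapses are white-box (gate
list ↦ quadratic normal forms ↦ threshold circuits / certificates); an oracle gate has no Dehaene–De
Moor form, so nothing here relativizes, consistent with BQP^O ⊄ BPP^O
(exists_oracle_BQPRel_not_subset_BPPRel); no statement about S itself is made.
- Literature.Barriers.QuantumAdvantage.Algebrization: not met — no inclusion C^A ⊆ D^Ã is proved by
arithmetization; crux 3's verification uses exact Gauss sums of the guessed objects, not low-degree
extensions of an oracle.
- Literature.Barriers.QuantumAdvantage.NaturalProofs: it bears on the HYPOTHESES, not on the route: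
¬(BQP ⊆ TC0)/¬(PP ⊆ TC0) are TC⁰ lower bounds, for which natural proofs are self-defeating if
NaorReingold2004 PRFs (in TC⁰) are secure; the route converts such beliefs into 0247, it does not
prove them, and it does NOT claim the converse (0247 ⇒ circuit lower bound), so no barrier is
transferred onto the stabilizer-rank problem. The NP ≠ coNP hypothesis of the exact conjunct is
barrier-free in this sense but P-vs-NP-hard.
- Literature.Barriers.QuantumAdvantage.SeparationPrerequisites: n/a — no separation S is derived;
the target is a conditional KILL of the ¬S-side hypothesis (a), in the direction 'classical lower
bound ⇒ magic lower bound' (the reverse of Parham's TC⁰-from-magic direction noted on the card).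
- Literature.Barriers.QuantumA

History (route lifecycle, newest last):
- 2026-08-15T13:50:50Z · CLOSED retired — not-a-thesis: assembly does not conclude the sub-problem Statement (operator:999:1257524)

sub-problem: QuantumAdvantage · status: closed(retired) · opened planner-plancard-QuantumAdvantage-QuantumAdva-a0889f14-0 2026-08-15T13:21:34Z · rev 0 · ledger route-QuantumAdvantage-CliffordParallel
GENERATED by the gate from the ledger (D-0016/17). Provers cite these decls: `theorem foo : Summit.QuantumAdvantage.QuantumAdvantage.Theses.CliffordParallel.<Decl> := …` in Summits/QuantumAdvantage/QuantumAdvantage/Theorems/<Name>.lean.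
-/

namespace Summit.QuantumAdvantage.QuantumAdvantage.Theses.CliffordParallel

open scoped BigOperators Topology Manifold Classical MeasureTheory ProbabilityTheory Matrix InnerProductSpace ComplexConjugate ContinuousMap
open Filter Set Function TopologicalSpace MeasureTheory

attribute [summit_statement] _root_.QuantumAdvantage

open Literature.QuantumAdvantage

/-- item stmt-QuantumAdvantage-8625 · target · rank 0 · closed · moot by None · by planner
why it might fail: It cannot fail given the cruxes (pure logic, proved in Sketch.lean); its VALUE fails if the hypotheses are as hard as 0247 itself: TC⁰ lower bounds for explicit languages face Natural Proofs (NaorReingold2004 PRFs in TC⁰), NP ≠ coNP is P-vs-NP-hard.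
sources: MehrabanTahmasbi2024, arXiv:2305.10277, PelegShpilkaVolk2022, RazborovRudich1997, NaorReingold2004
[target] (BQP ⊄ TC0/poly ⇒ superpolynomial δ-approximate stabilizer rank of |T⟩^⊗t for some δ ∈
(0,1), i.e. item 0247 verbatim) ∧ (PP ⊄ TC0/poly or PP ⊄ NP ⇒ superpolynomial exact stabilizer rank,
i.e. GenericAngle.ExactRankSuperpoly verbatim). -/
@[route_item "route-QuantumAdvantage-CliffordParallel"]
def ThresholdHypothesisKill : Prop :=
  (¬ (Literature.Computability.Cryptography.BQP ⊆ Literature.Computability.Complexity.TC0) → ∃ δ : ℝ, 0 < δ ∧ δ < 1 ∧ ∀ c : ℕ, ∃ t : ℕ, t ^ c + c < Literature.Computability.QuantumComplexity.approxStabilizerRank δ (Literature.Computability.QuantumComplexity.tensorPow Literature.Computability.QuantumComplexity.magicT t)) ∧ (¬ (Literature.Computability.Complexity.PP ⊆ Literature.Computability.Complexity.TC0) ∨ ¬ (Literature.Computability.Complexity.PP ⊆ Literature.Computability.Complexity.Nondeterministic.NP) → ∀ c : ℕ, ∃ t : ℕ, t ^ c + c < Literature.Computability.QuantumComplexity.stabilizerRank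 (Literature.Computability.QuantumComplexity.tensorPow Literature.Computability.QuantumComplexity.magicT t))

/-- item stmt-QuantumAdvantage-8626 · crux · rank 2 · closed · moot by None · by planner
why it might fail: Three exactness points: corrected-gadget branch identity; isometry of measure-and-correct (Σ_y‖v'_y−v_y‖² = ‖ψ'−T^⊗t‖²); TC⁰ (DepthSizeClass tcBasis) iterated addition + comparison of poly-bit ℤ[ω,½] numbers. δ=1/10 has slack (any δ<1/4 works); BQP needs amplification first.
sources: BravyiGosset2016, BravyiEtAl2019, MehrabanTahmasbi2024, DehaeneDemoor2003, Vandennest2010, Adleman1978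
[crux] if for some c and all t there is a list of ≤ t^c+c (T-free, oracle-free Clifford circuit on t
wires, Gaussian-rational coefficient of height ≤ 2^(t^c+c)) pairs whose combination of C_j|0^t⟩ is
within norm² 1/100 of |T⟩^⊗t, then every BQP language has polynomial-size constant-depth threshold
circuits (tree TC0). Proof plan: amplify; gadgetize the t(n) T-gates with corrected gadgets V_y;
branch identity ⟨y|V_y(|x0⟩⊗T^⊗t) = ω^|y| 2^(−t/2) U|x0⟩ and isometry ⇒ E_y[2^t‖v'_y−v_y‖²] ≤ 1/100;
Markov + Chernoff + union bound over x fix O(n) advice strings y; each p̂_y(x) = 2^t Σ c̄_i c_j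
⟨x00|C_i†V_y†P V_y C_j|x00⟩ is a sum of χ² sandwich values = advice constants × [affine tests] ×
ω^(quadratic(x)), evaluated and compared in TC⁰ (card K1, sharpened from NC³/2^(−t/2) to
TC⁰/constant δ). [deps: SandwichQuadraticForm] [difficulty: L] -/
@[route_item "route-QuantumAdvantage-CliffordParallel"]
def ApproxRankThresholdCollapse : Prop :=
  (∃ c : ℕ, ∀ t : ℕ, ∃ D : List (Literature.Computability.Cryptography.QCircuit Literature.Computability.Cryptography.cliffordT t × ℚ × ℚ), D.length ≤ t ^ c + c ∧ (∀ x ∈ D, x.1.IsOracleFree ∧ x.1.tCount = 0 ∧ x.2.1.num.natAbs ≤ 2 ^ (t ^ c + c) ∧ x.2.1.den ≤ 2 ^ (t ^ c + c) ∧ x.2.2.num.natAbs ≤ 2 ^ (t ^ c + c) ∧ x.2.2.den ≤ 2 ^ (t ^ c + c)) ∧ Literature.Computability.Cryptography.normSq (Literature.Computability.QuantumComplexity.tensorPow Literature.Computability.QuantumComplexity.magicT t - (D.map fun x => ((x.2.1 : ℂ) + (x.2.2 : ℂ) * Complex.I) • Matrix.mulVec (x.1.toMatrix 0) (Literature.Computability.Cryptography.zeroState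 t)).sum) ≤ 1 / 100) → Literature.Computability.Cryptography.BQP ⊆ Literature.Computability.Complexity.TC0

/-- item stmt-QuantumAdvantage-8627 · crux · rank 3 · closed · moot by None · by planner
why it might fail: Needs exact closure of stabilizer functions under pointwise product (i^a·i^b = i^(a⊕b)(−1)^(ab)) and conjugation, exact poly-time Gauss sums (BG16 App. A; tree gaussEval), and representations for EVERY gate with poly bits (Cramer over ℚ(ω)); T-count must stay O(circuit size) (7 T per Toffoli).
sources: Williams2018, arXiv:1802.09121, BravyiGosset2016, MehrabanTahmasbi2024, PelegShpilkaVolk2022, Labib2022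
[crux] if the decompositions of crux 2 exist EXACTLY (equality instead of norm² ≤ 1/100), then PP ⊆
NP. Proof plan (Williams2018 Lemma 3.1 with C = stabilizer functions): for a #SAT instance (the
P-predicate of a pMajority language on inputs of length n+p(n), as a fan-in-2 circuit),
nondeterministically guess for every gate a representation Σ_i α_i s_i(x) by ≤ poly stabilizer
functions s_i = 1_A·i^ℓ·(−1)^q with poly-bit α_i ∈ ℚ(ω) (they EXIST by SparsityTransfer + Cramer);
verify gate-by-gate the exact identities ρ_g = 1 − ρ_g1·ρ_g2 by computing Σ_x|ρ_g − 1 + ρ_g1ρ_g2|² =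
0 through O(r⁴) Sum-Products of ≤ 4 stabilizer functions, each a Clifford Gauss sum computed exactly
in poly time; then Σ_x ρ_out(x) = Σ α_i Γ(s_i) is the exact count; compare with half. [deps:
SparsityTransfer, PolyBitsOfExactRank] [difficulty: L] -/
@[route_item "route-QuantumAdvantage-CliffordParallel"]
def ExactRankCertificateCollapse : Prop :=
  (∃ c : ℕ, ∀ t : ℕ, ∃ D : List (Literature.Computability.Cryptography.QCircuit Literature.Computability.Cryptography.cliffordT t × ℚ × ℚ), D.length ≤ t ^ c + c ∧ (∀ x ∈ D, x.1.IsOracleFree ∧ x.1.tCount = 0 ∧ x.2.1.num.natAbs ≤ 2 ^ (t ^ c + c) ∧ x.2.1.den ≤ 2 ^ (t ^ c + c) ∧ x.2.2.num.natAbs ≤ 2 ^ (t ^ c + c) ∧ x.2.2.den ≤ 2 ^ (t ^ c + c)) ∧ Literature.Computability.QuantumComplexity.tensorPow Literature.Computability.QuantumComplexity.magicT t = (D.map fun x => ((x.2.1 : ℂ) + (x.2.2 : ℂ) * Complex.I) • Matrix.mulVec (x.1.toMatrix 0) (Literature.Computability.Cryptography.zeroState t)).sum) → Literature.Computability.Complexity.PP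 ⊆ Literature.Computability.Complexity.Nondeterministic.NP

/-- item stmt-QuantumAdvantage-8628 · crux · rank 4 · closed · moot by None · by planner
why it might fail: PostBQP probabilities may be 2^(−poly): the comparison must be EXACT in ℤ[√2,½] inside TC⁰ (needs TC⁰ multiplication, HesseAllenderBarrington2002); any hidden approximation breaks it; the sandwich magnitude κ must be x-independent (it is: the homogeneous constraint system does not see x).
sources: Aaronson2005, MehrabanTahmasbi2024, BravyiGosset2016, DehaeneDemoor2003, HesseAllenderBarrington2002
[crux] under the same exact hypothesis, PP ⊆ TC0 (non-uniform): by the proved PP ⊆ PostBQP (tree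
PPPostBQPAssembly) every PP language has a uniform Clifford+T family with postselection; with y =
0^t (no averaging needed for an exact resource) p(acc ∧ post) and p(post) are 2^t × sums of χ²
sandwich values, exact elements of ℤ[√2, 1/2] of poly bits computed in TC⁰ from advice, and
3·p(acc∧post) ≥ 2·p(post) is decided exactly (TC⁰ multiplication). Corollaries not filed: CH ⊆
TC0/poly, P^#P ⊆ TC0/poly (strengthening MT24 Thm 1.6's P^#P ⊆ P/poly). [deps:
SandwichQuadraticForm] [difficulty: L] -/
@[route_item "route-QuantumAdvantage-CliffordParallel"]
def ExactRankCountingCollapse : Prop :=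
  (∃ c : ℕ, ∀ t : ℕ, ∃ D : List (Literature.Computability.Cryptography.QCircuit Literature.Computability.Cryptography.cliffordT t × ℚ × ℚ), D.length ≤ t ^ c + c ∧ (∀ x ∈ D, x.1.IsOracleFree ∧ x.1.tCount = 0 ∧ x.2.1.num.natAbs ≤ 2 ^ (t ^ c + c) ∧ x.2.1.den ≤ 2 ^ (t ^ c + c) ∧ x.2.2.num.natAbs ≤ 2 ^ (t ^ c + c) ∧ x.2.2.den ≤ 2 ^ (t ^ c + c)) ∧ Literature.Computability.QuantumComplexity.tensorPow Literature.Computability.QuantumComplexity.magicT t = (D.map fun x => ((x.2.1 : ℂ) + (x.2.2 : ℂ) * Complex.I) • Matrix.mulVec (x.1.toMatrix 0) (Literature.Computability.Cryptography.zeroState t)).sum) → Literature.Computability.Complexity.PP ⊆ Literature.Computability.Complexity.TC0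

/-- item stmt-QuantumAdvantage-8629 · support · rank 9 · closed · moot by None · by planner
sources: MehrabanTahmasbi2024, PelegShpilkaVolk2022, BravyiEtAl2019
[support] polynomial (1/20)-approximate stabilizer rank (tree approxStabilizerRank, arbitrary
complex coefficients, arbitrarily long Clifford words) ⇒ the poly-bit Gaussian-rational data
hypothesis of crux 2 at precision 1/10: take an optimal φ' = Σ c_iφ_i with φ_i linearly independent;
‖c‖ ≤ 2^poly because the Gram determinant is a nonzero element of 2^(−tχ)ℤ[√2] (norm argument);
round Re/Im of c_i to poly bits (extra error ≤ 1/20); words from stabilizerStates t = Clifford orbit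
(convert Submonoid.closure placements to T-free QCircuit words). [difficulty: M] -/
@[route_item "route-QuantumAdvantage-CliffordParallel"]
def PolyBitsOfApproxRank : Prop :=
  (∃ c : ℕ, ∀ t : ℕ, Literature.Computability.QuantumComplexity.approxStabilizerRank (1 / 20) (Literature.Computability.QuantumComplexity.tensorPow Literature.Computability.QuantumComplexity.magicT t) ≤ t ^ c + c) → ∃ c : ℕ, ∀ t : ℕ, ∃ D : List (Literature.Computability.Cryptography.QCircuit Literature.Computability.Cryptography.cliffordT t × ℚ × ℚ), D.length ≤ t ^ c + c ∧ (∀ x ∈ D, x.1.IsOracleFree ∧ x.1.tCount = 0 ∧ x.2.1.num.natAbs ≤ 2 ^ (t ^ c + c) ∧ x.2.1.den ≤ 2 ^ (t ^ c + c) ∧ x.2.2.num.natAbs ≤ 2 ^ (t ^ c + c) ∧ x.2.2.den ≤ 2 ^ (t ^ c + c)) ∧ Literature.Computability.Cryptography.normSq (Literature.Computability.QuantumComplexity.tensorPow Literature.Computability.QuantumComplexity.magicT t - (D.map fun x => ((x.2.1 : ℂ) + (x.2.2 : ℂ) * Complex.I) • Matrix.mulVec (x.1.toMatrix 0) (Literature.Computability.Cryptography.zeroState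 t)).sum) ≤ 1 / 100

/-- item stmt-QuantumAdvantage-8630 · support · rank 9 · closed · moot by None · by planner
sources: MehrabanTahmasbi2024, PelegShpilkaVolk2022, AaronsonGottesman2004
[support] polynomial exact stabilizer rank ⇒ the exact poly-bit data hypothesis of cruxes 3–4:
coefficients are the unique solution of a ℚ(ω)-linear system (Cramer: poly bits; MT24 proof of Thm
1.6, PSV22 §1.4), ℚ(ω) = ℚ(i) ⊕ ω·ℚ(i) and ω·φ is again a stabilizer state ((SH)³ = ω·1), so rank at
most doubles with Gaussian-rational coefficients. [difficulty: M] -/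
@[route_item "route-QuantumAdvantage-CliffordParallel"]
def PolyBitsOfExactRank : Prop :=
  (∃ c : ℕ, ∀ t : ℕ, Literature.Computability.QuantumComplexity.stabilizerRank (Literature.Computability.QuantumComplexity.tensorPow Literature.Computability.QuantumComplexity.magicT t) ≤ t ^ c + c) → ∃ c : ℕ, ∀ t : ℕ, ∃ D : List (Literature.Computability.Cryptography.QCircuit Literature.Computability.Cryptography.cliffordT t × ℚ × ℚ), D.length ≤ t ^ c + c ∧ (∀ x ∈ D, x.1.IsOracleFree ∧ x.1.tCount = 0 ∧ x.2.1.num.natAbs ≤ 2 ^ (t ^ c + c) ∧ x.2.1.den ≤ 2 ^ (t ^ c + c) ∧ x.2.2.num.natAbs ≤ 2 ^ (t ^ c + c) ∧ x.2.2.den ≤ 2 ^ (t ^ c + c)) ∧ Literature.Computability.QuantumComplexity.tensorPow Literature.Computability.QuantumComplexity.magicT t = (D.map fun x => ((x.2.1 : ℂ) + (x.2.2 : ℂ) * Complex.I) • Matrix.mulVec (x.1.toMatrix 0) (Literature.Computability.Cryptography.zeroState t)).sum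

/-- item stmt-QuantumAdvantage-8631 · support · rank 9 · closed · moot by None · by planner
sources: DehaeneDemoor2003, Vandennest2010, BravyiGosset2016, GrierSchaeffer2019
[support] THE ENGINE. For T-free oracle-free circuits C, C' on N wires and a coordinate projector P
(pin the wires in S to the values v), the diagonal element x ↦ (C†·P·C')[x,x] on basis labels x ∈
𝔽₂^N equals [R x = r over 𝔽₂]·(√2)^m·ω^((e + Σ a_j x_j + Σ B_jl x_j x_l) mod 8) for fixed integer
data (m, R, r, e, a, B): Dehaene–De Moor form of the two Choi states, product, Gauss sum over the
internal register on an affine space whose homogeneous part is x-independent (radical character test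
= affine in x; completed square = quadratic in x). [difficulty: M] -/
@[route_item "route-QuantumAdvantage-CliffordParallel"]
def SandwichQuadraticForm : Prop :=
  ∀ (N : ℕ) (C C' : Literature.Computability.Cryptography.QCircuit Literature.Computability.Cryptography.cliffordT N), C.IsOracleFree → C'.IsOracleFree → C.tCount = 0 → C'.tCount = 0 → ∀ (S : Finset (Fin N)) (v : Fin N → Bool), ∃ (m : ℤ) (R : Fin N → Fin N → Bool) (r : Fin N → Bool) (e : ℤ) (a : Fin N → ℤ) (B : Fin N → Fin N → ℤ), ∀ x : Literature.Computability.Cryptography.QReg N, ((C.toMatrix 0)ᴴ * Matrix.diagonal (fun z : Literature.Computability.Cryptography.QReg N => if (∀ w ∈ S, z w = v w) then (1 : ℂ) else 0) * C'.toMatrix 0) x x = if (∀ i : Fin N, (∑ j : Fin N, (if R i j = true ∧ x j = true then (1 : ZMod 2) else 0)) = (if r i = true then (1 : ZMod 2) else 0)) then ((Real.sqrt 2 : ℝ) : ℂ) ^ m * Complex.exp (↑Real.pi * Complex.I / 4) ^ Int.toNat ((e + ∑ j : Fin N, (if x j = true then a j else 0) + ∑ j : Fin N, ∑ l : Fin N,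 (if x j = true ∧ x l = true then B j l else 0)) % 8) else 0

/-- item stmt-QuantumAdvantage-8632 · support · rank 9 · closed · moot by None · by planner
sources: BravyiGosset2016, PelegShpilkaVolk2022, Williams2018
[support] polynomial exact stabilizer rank of |T⟩^⊗t ⇒ for every fan-in-2 Boolean circuit C on n
inputs, the indicator vector Σ_x [C(x)]|x⟩ has stabilizer rank ≤ poly(size + n): compile C
reversibly into Clifford+T with 7 T per Toffoli and clean ancillas, apply the PROVED gadgetization
fact BravyiGosset2016_stabilizerRank_output_le_holds to U|+ⁿ,0⟩ = 2^(−n/2)Σ_x|x, C(x), 0⟩ and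
project the output/ancilla wires (projection onto a basis value does not increase rank). The
Boolean-function face of the hypothesis used by crux 3 (PSV22 §1.4's remark, made uniform in the
circuit). [difficulty: M] -/
@[route_item "route-QuantumAdvantage-CliffordParallel"]
def SparsityTransfer : Prop :=
  (∃ c : ℕ, ∀ t : ℕ, Literature.Computability.QuantumComplexity.stabilizerRank (Literature.Computability.QuantumComplexity.tensorPow Literature.Computability.QuantumComplexity.magicT t) ≤ t ^ c + c) → ∃ c : ℕ, ∀ (n : ℕ) (C : Literature.Computability.Complexity.Circuit (Fin n)), C.IsOver Literature.Computability.Complexity.B2 → Literature.Computability.QuantumComplexity.stabilizerRank (fun x : Literature.Computability.Cryptography.QReg n => if C.eval x = true then (1 : ℂ) else 0) ≤ (C.size + n) ^ c + c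

/-- item stmt-QuantumAdvantage-8633 · support · rank 9 · closed · moot by None · by planner
sources: MehrabanTahmasbi2024, BravyiGosset2016, Adleman1978
[support] the special case of crux 2 for classical languages: the approximate data hypothesis ⇒ P ⊆
TC0 (reversible circuits have Boolean branch amplitudes a_y(x) =
ω^(−|y|)2^(t/2)⟨x,1,0,y|V_y(|x0⟩⊗ψ')⟩ ≈ L(x); no probabilities, no amplification) — the natural
first target for provers and the form in which 'P ⊄ TC0/poly ⇒ 0247' is read. [difficulty: M] -/
@[route_item "route-QuantumAdvantage-CliffordParallel"]
def ClassicalThresholdCollapse : Prop :=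
  (∃ c : ℕ, ∀ t : ℕ, ∃ D : List (Literature.Computability.Cryptography.QCircuit Literature.Computability.Cryptography.cliffordT t × ℚ × ℚ), D.length ≤ t ^ c + c ∧ (∀ x ∈ D, x.1.IsOracleFree ∧ x.1.tCount = 0 ∧ x.2.1.num.natAbs ≤ 2 ^ (t ^ c + c) ∧ x.2.1.den ≤ 2 ^ (t ^ c + c) ∧ x.2.2.num.natAbs ≤ 2 ^ (t ^ c + c) ∧ x.2.2.den ≤ 2 ^ (t ^ c + c)) ∧ Literature.Computability.Cryptography.normSq (Literature.Computability.QuantumComplexity.tensorPow Literature.Computability.QuantumComplexity.magicT t - (D.map fun x => ((x.2.1 : ℂ) + (x.2.2 : ℂ) * Complex.I) • Matrix.mulVec (x.1.toMatrix 0) (Literature.Computability.Cryptography.zeroState t)).sum) ≤ 1 / 100) → Literature.Computability.Complexity.Classes.P ⊆ Literature.Computability.Complexity.TC0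

/-- item stmt-QuantumAdvantage-8634 · support · rank 9 · closed · moot by None · by planner
sources: BravyiGosset2016, AaronsonGottesman2004, DehaeneDemoor2003
[support] calibration rung (card P1, sharpened from P/NC² to TC⁰): a poly-time-uniform oracle-free
Clifford+T family with T-count ≤ c·log₂ n + c decides (gap 2/3,1/3) only languages in TC0: expand T
= αI + βZ into 4^t = poly sandwich terms, each [affine]·(√2)^m·ω^quadratic by SandwichQuadraticForm,
summed and compared in TC⁰ (sibling of Dequantize.DeqLogTcountInPV2, which concludes P).
[difficulty: M] -/
@[route_item "route-QuantumAdvantage-CliffordParallel"]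
def LogTcountTC0 : Prop :=
  ∀ F : Literature.Computability.Cryptography.QCircuitFamily Literature.Computability.Cryptography.cliffordT, F.IsOracleFree → F.IsUniform → (∃ c : ℕ, ∀ n, (F.circ n).tCount ≤ c * Nat.log 2 n + c) → ∀ L : Language Bool, (∀ x, (x ∈ L → 2 / 3 ≤ F.acceptProbOn 0 x) ∧ (x ∉ L → F.acceptProbOn 0 x ≤ 1 / 3)) → L ∈ Literature.Computability.Complexity.TC0

/-- item stmt-QuantumAdvantage-8635 · assembly · rank 1 · closed · moot by None · by planner
sources: MehrabanTahmasbi2024, BravyiGosset2016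
[assembly] ApproxRankThresholdCollapse → ExactRankCertificateCollapse → ExactRankCountingCollapse →
PolyBitsOfApproxRank → PolyBitsOfExactRank → ThresholdHypothesisKill (the target; its consequents
are Dequantize.DeqNegStabrankSuperpoly and GenericAngle.ExactRankSuperpoly verbatim). -/
@[route_item "route-QuantumAdvantage-CliffordParallel"]
def Assembly : Prop :=
  ApproxRankThresholdCollapse → ExactRankCertificateCollapse → ExactRankCountingCollapse → PolyBitsOfApproxRank → PolyBitsOfExactRank → ThresholdHypothesisKill

end Summit.QuantumAdvantage.QuantumAdvantage.Theses.CliffordParallel
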